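import Mathlib
import Summits.Ventures.PercRepro2.K5K3Merge

/-!
# THE TYPED `K₃` BASE ON EVERY ALL-MARKED MULTIGRAPH
(blind cell PercRepro2, typer-1 g10; lead g26 03:45:52Z (3) / 04:03:50Z (3) «K5TypedK3 on five-mark
MULTIGRAPHS with the adjoined-object tables», mine-1 §23.9–§23.11)

A parallel pair `e, e'` never changes the open graph when `e'` is merged into `e` (`openGraph_mergeC`), so
p1's kernel `K₃` is invariant under the merge (`K3_mergeT`, through `K3_congr_conn`: `K₃` only reads
connections), and the typed parallel rule `typedCount_merge` (`K5K3Merge.lean`) writes a typed count with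
the pair as a nonnegative combination of typed counts with one edge fewer.  By strong induction on the
number of typed edges, down to the parallel-free case of `K5K3Transfer.lean`:

* **`typedCount_K3_nonneg_multi_of_certs`**: for marks with `a₁, a₂` distinct from every other mark and
  `o ≠ a₃`, every typed count `typedCount F (fun _ => false) τ (K3 ends o a₁ a₂ a₃ b)` on a set `F` of
  typed edges whose ends are all marks — LOOPS AND PARALLEL EDGES ALLOWED (a typed loop is the factor
  `C(3, τ e)`, `typedCount_loop`), every type map — is `≥ 0`, given the three `K₅` certificates.  Instantiated in `K5TypedK3Marks.lean` (`typedCount_K3_nonneg_multi`):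
  the typed bases of mine-1's adjoined objects (a parallel type-2 edge at a mark pair, two type-1 edges
  at the third neighbour) are in the kernel.
-/

namespace Summit.Ventures.PercRepro2

namespace K5

/-! ## The merge does not change the open graph -/

section Graph

variable {V : Type*} {E : Type*} [DecidableEq E] (ends : E → Sym2 V)

/-- Closing the edge `e` in a triple. -/
def closeT (e : E) (T : Tri E) : Tri E := upd T e (false, false, false)

/-- The merge of `e'` into `e` on one configuration. -/
def mergeC (e e' : E) (ω : Config E) : Config E :=
  Function.update (Function.update ω e (ω e || ω e')) e' false

/-- The components of `mergeT` are `mergeC`. -/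
lemma mergeT_fst (e e' : E) (T : Tri E) : (mergeT e e' T).1 = mergeC e e' T.1 := rfl
/-- The second component of `mergeT` is `mergeC`. -/
lemma mergeT_snd (e e' : E) (T : Tri E) : (mergeT e e' T).2.1 = mergeC e e' T.2.1 := rfl
/-- The third component of `mergeT` is `mergeC`. -/
lemma mergeT_thd (e e' : E) (T : Tri E) : (mergeT e e' T).2.2 = mergeC e e' T.2.2 := rfl

/-- Open adjacency is unchanged by merging a parallel edge. -/
lemma openAdj_mergeC {e e' : E} (hpar : ends e = ends e') (hne : e ≠ e') (ω : Config E) (u v : V) :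
    OpenAdj ends (mergeC e e' ω) u v ↔ OpenAdj ends ω u v := by
  constructor
  · rintro ⟨g, hg, hends⟩
    by_cases hge' : g = e'
    · subst hge'
      simp [mergeC] at hg
    · rw [mergeC, Function.update_of_ne hge'] at hg
      by_cases hge : g = e
      · subst hge
        rw [Function.update_self, Bool.or_eq_true] at hg
        rcases hg with hg | hg
        · exact ⟨g, hg, hends⟩
        · exact ⟨e', hg, hpar ▸ hends⟩
      · rw [Function.update_of_ne hge] at hg
        exact ⟨g, hg, hends⟩
  · rintro ⟨g, hg, hends⟩
    by_cases hge' : g = e'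
    · subst hge'
      refine ⟨e, ?_, hpar.trans hends⟩
      rw [mergeC, Function.update_of_ne hne, Function.update_self, hg, Bool.or_true]
    · by_cases hge : g = e
      · subst hge
        refine ⟨g, ?_, hends⟩
        rw [mergeC, Function.update_of_ne hne, Function.update_self, hg, Bool.true_or]
      · refine ⟨g, ?_, hends⟩
        rw [mergeC, Function.update_of_ne hge', Function.update_of_ne hge]
        exact hg

/-- **The open graph is unchanged by merging a parallel edge.** -/
lemma openGraph_mergeC {e e' : E} (hpar : ends e = ends e') (hne : e ≠ e') (ω : Config E) :
    openGraph ends (mergeC e e' ω) = openGraph ends ω := by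
  ext u v
  rw [openGraph_adj, openGraph_adj, openAdj_mergeC ends hpar hne]

/-- Connectivity is unchanged by merging a parallel edge. -/
lemma conn_mergeC {e e' : E} (hpar : ends e = ends e') (hne : e ≠ e') (ω : Config E) (u v : V) :
    Conn ends (mergeC e e' ω) u v ↔ Conn ends ω u v := by
  unfold Conn
  rw [openGraph_mergeC ends hpar hne]

end Graph

/-! ## `K₃` only reads connections -/

section Kernel

variable {V : Type*} {E : Type*} {R : Type*} [Field R] (ends : E → Sym2 V)

/-- Indicators of events agree along an equivalence of memberships (same graph). -/
lemma indicator_eq_of_iff' {X : Set (Config E)} {ω ω' : Config E} (h : ω ∈ X ↔ ω' ∈ X) :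
    X.indicator (1 : Config E → R) ω = X.indicator (1 : Config E → R) ω' := by
  by_cases hω : ω ∈ X
  · rw [Set.indicator_of_mem hω, Set.indicator_of_mem (h.1 hω)]
    rfl
  · rw [Set.indicator_of_notMem hω, Set.indicator_of_notMem (fun h' => hω (h.2 h'))]

/-- A connection indicator at two configurations with the same connections. -/
lemma indicator_connEvent_congr {ω ω' : Config E} (h : ∀ u v, Conn ends ω u v ↔ Conn ends ω' u v)
    (u v : V) :
    (connEvent ends u v).indicator (1 : Config E → R) ω = (connEvent ends u v).indicator 1 ω' :=
  indicator_eq_of_iff' (by rw [mem_connEvent, mem_connEvent]; exact h u v)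

/-- The indicator of `Q` at two configurations with the same connections. -/
lemma indicator_avoidAll_congr {ω ω' : Config E} (h : ∀ u v, Conn ends ω u v ↔ Conn ends ω' u v)
    (a₁ a₂ : V) :
    (avoidAll ends a₂ {a₁}).indicator (1 : Config E → R) ω = (avoidAll ends a₂ {a₁}).indicator 1 ω' := by
  refine indicator_eq_of_iff' ?_
  simp only [mem_avoidAll, Finset.mem_singleton, forall_eq]
  rw [h a₂ a₁]

/-- The indicator of `PD` at two configurations with the same connections. -/
lemma indicator_PDEvent_congr {ω ω' : Config E} (h : ∀ u v, Conn ends ω u v ↔ Conn ends ω' u v)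
    (a₁ a₂ a₃ : V) :
    (PDEvent ends a₁ a₂ a₃).indicator (1 : Config E → R) ω = (PDEvent ends a₁ a₂ a₃).indicator 1 ω' := by
  refine indicator_eq_of_iff' ?_
  simp only [PDEvent, Dtilde, UnionCluster.inU, Set.mem_inter_iff, Set.mem_compl_iff, Set.mem_union,
    mem_connEvent]
  rw [h a₁ a₂, h a₃ a₁, h a₃ a₂]

/-- **`K₃` only reads connections**: at triples with the same connections it takes the same value. -/
theorem K3_congr_conn (o a₁ a₂ a₃ b : V) {x x' y y' w w' : Config E}
    (hx : ∀ u v, Conn ends x u v ↔ Conn ends x' u v) (hy : ∀ u v, Conn ends y u v ↔ Conn ends y' u v)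
    (hw : ∀ u v, Conn ends w u v ↔ Conn ends w' u v) :
    CovForm.K3 (R := R) ends o a₁ a₂ a₃ b x y w = CovForm.K3 (R := R) ends o a₁ a₂ a₃ b x' y' w' := by
  unfold CovForm.K3 CovForm.sepKernel CovForm.f3 CovForm.f4 CovForm.f5 CovForm.f6 CovForm.f7 CovForm.f10
    CovForm.f11 CovForm.f12 CovForm.sigma CovForm.inU CovForm.iQ CovForm.iPD CovForm.iL CovForm.iH
  simp only [Fin.sum_univ_succ, Fin.sum_univ_zero, Matrix.cons_val_zero, Matrix.cons_val_succ, add_zero,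
    indicator_connEvent_congr ends hx, indicator_connEvent_congr ends hy, indicator_connEvent_congr ends hw,
    indicator_avoidAll_congr ends hx, indicator_avoidAll_congr ends hy, indicator_avoidAll_congr ends hw,
    indicator_PDEvent_congr ends hx, indicator_PDEvent_congr ends hy, indicator_PDEvent_congr ends hw]

/-- **`K₃` is invariant under the merge of a parallel pair.** -/
theorem K3_mergeT [DecidableEq E] (o a₁ a₂ a₃ b : V) {e e' : E} (hpar : ends e = ends e') (hne : e ≠ e')
    (T : Tri E) :
    CovForm.K3 (R := R) ends o a₁ a₂ a₃ b T.1 T.2.1 T.2.2 =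
      CovForm.K3 (R := R) ends o a₁ a₂ a₃ b (mergeT e e' T).1 (mergeT e e' T).2.1 (mergeT e e' T).2.2 := by
  rw [mergeT_fst, mergeT_snd, mergeT_thd]
  exact K3_congr_conn ends o a₁ a₂ a₃ b (fun u v => (conn_mergeC ends hpar hne _ u v).symm)
    (fun u v => (conn_mergeC ends hpar hne _ u v).symm) (fun u v => (conn_mergeC ends hpar hne _ u v).symm)

/-- **The open graph is unchanged by closing a loop.** -/
lemma openGraph_closeLoop [DecidableEq E] {e : E} (hloop : (ends e).IsDiag) (ω : Config E) :
    openGraph ends (Function.update ω e false) = openGraph ends ω := by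
  ext u v
  rw [openGraph_adj, openGraph_adj]
  constructor
  · rintro ⟨huv, g, hg, hends⟩
    refine ⟨huv, g, ?_, hends⟩
    by_cases hge : g = e
    · subst hge; simp at hg
    · rwa [Function.update_of_ne hge] at hg
  · rintro ⟨huv, g, hg, hends⟩
    refine ⟨huv, g, ?_, hends⟩
    by_cases hge : g = e
    · subst hge
      exfalso
      apply huv
      rw [hends] at hloop
      exact Sym2.mk_isDiag_iff.1 hloop
    · rwa [Function.update_of_ne hge]

/-- Connectivity is unchanged by closing a loop. -/
lemma conn_closeLoop [DecidableEq E] {e : E} (hloop : (ends e).IsDiag) (ω : Config E) (u v : V) :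
    Conn ends (Function.update ω e false) u v ↔ Conn ends ω u v := by
  unfold Conn
  rw [openGraph_closeLoop ends hloop]

/-- **`K₃` is invariant under closing a loop.** -/
theorem K3_closeT [DecidableEq E] (o a₁ a₂ a₃ b : V) {e : E} (hloop : (ends e).IsDiag) (T : Tri E) :
    CovForm.K3 (R := R) ends o a₁ a₂ a₃ b T.1 T.2.1 T.2.2 =
      CovForm.K3 (R := R) ends o a₁ a₂ a₃ b (closeT e T).1 (closeT e T).2.1 (closeT e T).2.2 :=
  K3_congr_conn ends o a₁ a₂ a₃ b (fun u v => (conn_closeLoop ends hloop _ u v).symm)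
    (fun u v => (conn_closeLoop ends hloop _ u v).symm) (fun u v => (conn_closeLoop ends hloop _ u v).symm)

end Kernel

/-! ## The typed loop rule -/

section Loop

variable {V : Type*} {E : Type*} [Fintype E] [DecidableEq E] {R : Type*} [CommRing R]

/-- The number of copy vectors of weight `a` (`C(3, a)` for `a ≤ 3`, `0` otherwise). -/
def loopCoef (a : ℕ) : ℕ := (Finset.univ.filter fun p : Vec3 => wt p = a).card

omit [Fintype E] in
/-- A typed triple with `e` closed is typed for `F.erase e`, and its copy vector at `e` has weight `τ e`. -/
lemma closeT_typed {F : Finset E} {τ : E → ℕ} {e : E} (he : e ∈ F) {T : Tri E} (hT : Typed F τ T) :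
    Typed (F.erase e) τ (closeT e T) ∧ wt (vec T e) = τ e := by
  obtain ⟨h1, h2⟩ := hT
  refine ⟨⟨fun g hg => ?_, fun g hg => ?_⟩, h2 e he⟩
  · by_cases hge : g = e
    · subst hge
      exact vec_upd_self _ _ _
    · rw [closeT, vec_upd_of_ne _ hge]
      exact h1 g fun hgF => hg (Finset.mem_erase.2 ⟨hge, hgF⟩)
  · rw [Finset.mem_erase] at hg
    rw [closeT, vec_upd_of_ne _ hg.1]
    exact h2 g hg.2

omit [Fintype E] in
/-- The inverse: put a copy vector of weight `τ e` back at `e`. -/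
lemma typed_upd_loop {F : Finset E} {τ : E → ℕ} {e : E} (he : e ∈ F) {T' : Tri E}
    (hT' : Typed (F.erase e) τ T') {p : Vec3} (hp : wt p = τ e) :
    Typed F τ (upd T' e p) ∧ closeT e (upd T' e p) = T' ∧ vec (upd T' e p) e = p := by
  obtain ⟨h1, h2⟩ := hT'
  refine ⟨⟨fun g hg => ?_, fun g hg => ?_⟩, ?_, vec_upd_self _ _ _⟩
  · have hge : g ≠ e := fun h => hg (h ▸ he)
    rw [vec_upd_of_ne _ hge]
    exact h1 g fun h => hg (Finset.mem_erase.1 h).2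
  · by_cases hge : g = e
    · subst hge; rw [vec_upd_self]; exact hp
    · rw [vec_upd_of_ne _ hge]
      exact h2 g (Finset.mem_erase.2 ⟨hge, hg⟩)
  · refine tri_ext fun g => ?_
    by_cases hge : g = e
    · subst hge
      rw [closeT, vec_upd_self, h1 g (fun h => (Finset.mem_erase.1 h).1 rfl)]
    · rw [closeT, vec_upd_of_ne _ hge, vec_upd_of_ne _ hge]

/-- **The typed loop rule**: for a kernel invariant under closing `e`,
`typedCount F false τ K = C(3, τ e) · typedCount (F.erase e) false τ K`. -/
theorem typedCount_loop (F : Finset E) (τ : E → ℕ) (K : Config E → Config E → Config E → R) {e : E}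
    (he : e ∈ F)
    (hK : ∀ T : Tri E, K T.1 T.2.1 T.2.2 = K (closeT e T).1 (closeT e T).2.1 (closeT e T).2.2) :
    typedCount F (fun _ => false) τ K =
      (loopCoef (τ e) : R) * typedCount (F.erase e) (fun _ => false) τ K := by
  have hL : typedCount F (fun _ => false) τ K =
      ∑ T' : Tri E, ∑ p : Vec3,
        if Typed (F.erase e) τ T' ∧ wt p = τ e then K T'.1 T'.2.1 T'.2.2 else 0 := by
    rw [typedCount_eq_sum_Typed, ← Fintype.sum_prod_type']
    refine sum_ite_nbij _ _ _ _ (fun T => (closeT e T, vec T e)) _ _ ?_ ?_ ?_ ?_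
    · intro T hT
      exact closeT_typed he hT
    · intro T T₂ _ _ h
      simp only [Prod.mk.injEq] at h
      obtain ⟨hm, hv⟩ := h
      refine tri_ext fun g => ?_
      by_cases hge : g = e
      · subst hge; exact hv
      · rw [← vec_upd_of_ne T hge (false, false, false), ← vec_upd_of_ne T₂ hge (false, false, false)]
        exact congrArg (fun S => vec S g) hm
    · rintro ⟨T', p⟩ ⟨hT', hp⟩
      obtain ⟨h1, h2, h3⟩ := typed_upd_loop he hT' hp
      exact ⟨upd T' e p, h1, by simp only [h2, h3]⟩
    · intro T _
      exact hK T
  rw [hL, typedCount_eq_sum_Typed, Finset.mul_sum]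
  refine Finset.sum_congr rfl fun T' _ => ?_
  by_cases hT' : Typed (F.erase e) τ T'
  · simp only [hT', true_and, if_true]
    rw [← Finset.sum_filter, Finset.sum_const, nsmul_eq_mul]
    rfl
  · simp only [hT', false_and, if_false, Finset.sum_const_zero, mul_zero]

end Loop

/-! ## The induction -/

section Multi

variable {V : Type*} {E : Type*} [Fintype E] [DecidableEq E] [DecidableEq V]
variable {R : Type*} [Field R] [LinearOrder R] [IsStrictOrderedRing R]

/-- **THE TYPED `K₃` BASE ON EVERY ALL-MARKED MULTIGRAPH**, given the three `K₅` certificates: loops and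
parallel typed edges allowed, every type map. -/
theorem typedCount_K3_nonneg_multi_of_certs (c4 : Cert3 4) (c3 : Cert3 3) (c0 : Cert3 0)
    (ends : E → Sym2 V) {o a₁ a₂ a₃ b : V} (h12 : a₁ ≠ a₂) (h31 : a₃ ≠ a₁) (h32 : a₃ ≠ a₂) (ho1 : o ≠ a₁)
    (ho2 : o ≠ a₂) (hb1 : b ≠ a₁) (hb2 : b ≠ a₂) (ho3 : o ≠ a₃) (F : Finset E) (τ : E → ℕ)
    (hall : ∀ e ∈ F, ∀ v ∈ ends e, v = o ∨ v = a₁ ∨ v = a₂ ∨ v = a₃ ∨ v = b) :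
    0 ≤ typedCount F (fun _ => false) τ (CovForm.K3 (R := R) ends o a₁ a₂ a₃ b) := by
  induction hn : F.card using Nat.strong_induction_on generalizing F τ with
  | _ n ih =>
  by_cases hl : ∃ e ∈ F, (ends e).IsDiag
  · obtain ⟨e, he, hloop⟩ := hl
    rw [typedCount_loop F τ _ he (K3_closeT ends o a₁ a₂ a₃ b hloop)]
    refine mul_nonneg (Nat.cast_nonneg _) ?_
    refine ih (F.erase e).card ?_ (F.erase e) τ ?_ rfl
    · rw [← hn]
      exact Finset.card_erase_lt_of_mem he
    · exact fun g hg => hall g (Finset.mem_of_mem_erase hg)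
  by_cases hpar : ∃ e ∈ F, ∃ e' ∈ F, e ≠ e' ∧ ends e = ends e'
  · obtain ⟨e, he, e', he', hne, hpar⟩ := hpar
    rw [typedCount_merge F τ _ he he' hne (K3_mergeT ends o a₁ a₂ a₃ b hpar hne)]
    refine Finset.sum_nonneg fun t _ => mul_nonneg (Nat.cast_nonneg _) ?_
    refine ih (F.erase e').card ?_ (F.erase e') (Function.update τ e t) ?_ rfl
    · rw [← hn]
      exact Finset.card_erase_lt_of_mem he'
    · exact fun g hg => hall g (Finset.mem_of_mem_erase hg)
  · exact typedCount_K3_nonneg_of_marks c4 c3 c0 ends h12 h31 h32 ho1 ho2 hb1 hb2 ho3 F τ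
      (fun e he h => hl ⟨e, he, h⟩)
      (fun e he e' he' h => by
        by_contra hne
        exact hpar ⟨e, he, e', he', hne, h⟩) hall

end Multi

end K5

end Summit.Ventures.PercRepro2
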